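import Summits.QuantumFields.BalabanUV.T4Continuum.Support.B13AssemblyCoresEndSubstrateAmbient
import Summits.QuantumFields.BalabanUV.T4Continuum.Support.SubstrateGaussianLettersBall

/-!
# B13AssemblyCoresEndSubstrateLetters — row O1-d2-ii «act instance», follower 3∕3: THE (2.14)-FACTOR-CORE END OF RECORD AT THE SUBSTRATE's SLOTS
# OF RECORD ON `measOp` WITH THE TWO FACTOR-LETTER BINDER BLOCKS `hNf` ∕ `hqf` **DISCHARGED INTO THE SUBSTRATE's PRIMITIVE PER-FACTOR LETTER
# CONDITIONS** by the S-U3 suppliers BY NAME — `SubstrateGaussianLettersBall.differentiableOn_gaussN_linForm ∕ norm_gaussN_linForm_le` (p219975, its FIRST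
# consumer in the tree) and `SubstrateGaussianLetters.measurable_gaussN ∕ measurable_linForm ∕ aestronglyMeasurable_gaussQ ∕ differentiableOn_gaussQ ∕
# differentiableOn_linForm ∕ margin_gaussQ_linForm` (p219426) — at module 2's ambient socket (cell `pub-balaban`, T⁴ fan-out, row NE5; unit
# `b2b-balaban-t4-ne5-formalise-leaf-08`, gen 6; junction probe `…/leaf-08/g6/probe/ProbeS_U3Junction.lean` J1–J6)

HONEST FRAMING (T4-DAG PAGE 1).  Rung (B)+1 on ONE finite four-torus of fixed physical size — NOT infinite volume, NOT a mass gap, NOT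
the Clay problem; `FlowStep.BetaPertH`, (B), (B^μ) do not occur here.  NE5 (`T4OutputRate.NE5`) is NOT PRINTED and NOT PROVED (spine
0/9, unchanged): the END below is an IMPLICATION from displayed binders — «NE5 ⇐ the instance» (trigger c5), NOT «NE5 proved».  The O1
INSTANCE and its letters are the SUBSTRATE cell's (Q-NE9-O1, DESIGN RULE R34, MAP §O1 S-U3); this file APPLIES the substrate's landed letter lemmas
BY NAME at NE5's END socket (CLAIM RULE 3) and asserts NOTHING about Bałaban's data: WHICH tables `base ∕ rd ∕ coords` realise `C^{(k)}(Z₀,σ)`, `Γ_k`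
of [Balaban1988RG2Cluster] (2.14) p. 15, and WHETHER the datum of record satisfies the displayed centre conditions (real positive-definite centre
form, entry bounds) and radius smallness (`detBudget < d₀`, `card·ϑ·R̄ < γ − 2m⋆`) is NOT claimed — those stay DISPLAYED, now as finitely many
scalar inequalities per factor instead of holomorphy ∕ measurability ∕ bound ∕ margin clauses.  0 cite tags; printed KIND only; 0 `def`.
HONEST DEPENDENCY (cell, verbatim): continuum YM on T⁴ ⇐ BetaPertH ∧ nine spine estimates (0/9 proved); BetaPertH ⇐ (D1) ∧ (D4) ∧ CAP+tail;
G-an2-4 gates asym, D1 and NE2/3/4.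

WHAT THIS MODULE IS (bookkeeping ∕ [folklore]; one application BY NAME after plugging six substrate lemmas; no estimate):
* §1 **`ne5_substrate_cores_actNorm_letters`** — module 2's `ne5_substrate_cores_actNorm_ambient` with
  - `hNf` (a.e.-strong measurability of `N op`, holomorphy of `op ↦ N op p` on the ambient ball, the bound `‖N op p‖ ≤ N₀f`) DISCHARGED from: measurability
    of the tables `base`, `rd` in the contour parameter (`hbase`, `hrdm`); per factor `(Z, j)` scalars `β₀ ≥ 0` (centre entry bound), `ϑ ≥ 0` (read-out
    norm bound `‖rd p ii jj‖ ≤ ϑ`), `d₀ > 0`; the CENTRE CONDITIONS at run B's datum of record `opOf (slotsOfRecord …).F (slotsOfRecord …).rawB g U k`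
    (`hctr`: entries `≤ β₀`, determinant REAL with real part `≥ d₀`, `γ`-coercivity, and the determinant-budget smallness `detBudget (card mI) β₀ ϑ
    (R′ k) < d₀` of the operator radius at that level) — with the bound letter SPECIALISED to p219975's `N₀f Z j := gaussC (mI Z j) · √(max 1 ((card mI)! · β₀^{card mI} + d₀))`
    (its sign `hN₀` thereby PROVED, not displayed);
  - `hqf` (joint measurability of `q op`, holomorphy of `op ↦ q op p v`, the margin `mf·‖v‖² − bf ≤ Re (q op p v)`) DISCHARGED from the same
    measurability letters, the centre coercivity (`hctr`, last clause), `hrd`, `0 ≤ ϑ` and a uniform radius bound `R′ k ≤ R̄` (`hRbar`) — with the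
    margin letters SPECIALISED to `mf Z j := (γ Z j − card (mI Z j)·ϑ Z j·R̄)∕2`, `bf := 0` (p219426's `margin_gaussQ_linForm` at radius `R′ k`,
    monotone in the radius);
  - every other binder of module 2 VERBATIM (with `N₀f ∕ mf ∕ bf` so specialised inside `hmf` and `hdec`); conclusion LITERALLY
    `T4OutputRate.NE5 (B13StepOfRecord.outA (slotsOfRecord …) E₀ cB) (B13StepOfRecord.outB (slotsOfRecord …) E₀ cB) W κ θ′ C₅`, the diamond's `C₅`.
* §2 **`exists_ne5_substrate_cores_actNorm_letters`** — the chained face (module 2 §2) the same way ⟹ `∃ C₅, NE5 …`.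
CENSUS vs module 2 §1 ∕ §2 (binders, by name): MINUS = [N₀f, mf, bf (specialised), hN₀ (proved), hNf, hqf]; PLUS = [β₀, ϑ, d₀, γ, R̄ (letters), hbase,
hrdm, hβ₀, hϑ, hd₀, hRbar, hrd, hctr]; rest IDENTICAL up to the specialisation of `N₀f ∕ mf ∕ bf` in `hmf` ∕ `hdec`; conclusions IDENTICAL.
STATUS (census, Edison rule).  DISPLAYED at the instance on `measOp`: slice budgets, levels L05∕L06 of the instance's outputs, W1 + floor, W4, rooms,
history radius, `A′` ∕ decay split (now against the explicit `N₀f`, `bf = 0`) ∕ `Φ′`, sizes, `m⋆ ≤ mf` (= the arithmetic smallness `card·ϑ·R̄ <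
γ − 2m⋆` per factor), and the substrate-level letter conditions listed above.  NOTHING of Bałaban's (2.14) data is asserted; 0/12 leaves; NE5 NOT
PROVED; spine 0/9; rung (B)+1 finite T⁴; NOT infinite volume ∕ mass gap ∕ Clay.  0 sorry; axioms ⊆ {propext, Classical.choice, Quot.sound}.
-/

noncomputable section

open scoped BigOperators Matrix
open Metric MeasureTheory

namespace Summit.QuantumFields.BalabanUV.T4Continuum.B13AssemblyCoresEndSubstrateLetters

open Literature.MathematicalPhysics.QuantumFieldTheory.Balaban1983to89
open Literature.MathematicalPhysics.QuantumFieldTheory.Balaban1983to89.T4OutputRate (DecayBound NE5)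
open Literature.MathematicalPhysics.QuantumFieldTheory.Balaban1983to89.B5Prop11Plancherel (Tor)
open Summit.QuantumFields.BalabanUV.T4Continuum.B13OpDatum (OpDatum FormatBounded)
open Summit.QuantumFields.BalabanUV.T4Continuum.B13OpDatumJunctions (opOf RawBounded WeightedEntrywiseRate)
open Summit.QuantumFields.BalabanUV.T4Continuum.B13StepTermLabels (InnerLabel)
open Summit.QuantumFields.BalabanUV.T4Continuum.B13InnerData (Bnd b13InnerData)
open Summit.QuantumFields.BalabanUV.T4Continuum.B13HistMeasurable (MeasPotFrame B13HistM)
open Summit.QuantumFields.BalabanUV.T4Continuum.B13TermCoreFamily (factorCores)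
open Summit.QuantumFields.BalabanUV.T4Continuum.B13TermCoreMass (factorMass)
open Summit.QuantumFields.BalabanUV.T4Continuum.UrsellTreeSum (ind)
open Summit.QuantumFields.BalabanUV.T4Continuum.UrsellTermBudget (actSum)
open Summit.QuantumFields.BalabanUV.T4Continuum.B13DomainGeometryTR (SCube footprint)
open Summit.QuantumFields.BalabanUV.T4Continuum.B13StepOfRecord (assembly step)
open Summit.QuantumFields.BalabanUV.T4Continuum.SubstrateBackgroundTransporters (unitMod)
open Summit.QuantumFields.BalabanUV.T4Continuum.SubstrateTwoRunsDriven (DrivenRuns)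
open Summit.QuantumFields.BalabanUV.T4Continuum.SubstrateRawSpecies (rawAOfRecord rawBOfRecord)
open Summit.QuantumFields.BalabanUV.T4Continuum.SubstrateSlotsOfRecord (SpeciesRec SlotLetters slotsOfRecord)
open Summit.QuantumFields.BalabanUV.T4Continuum.B13AssemblyCoresEndRestrictRecord (coresRec)
open Literature.MathematicalPhysics.QuantumFieldTheory.Balaban1983to89.B5Prop11Lower (nsq)
open Summit.QuantumFields.BalabanUV.T4Continuum.SubstrateGaussianLetters (gaussC gaussC_pos linForm measurable_gaussN measurable_linForm
  aestronglyMeasurable_gaussQ differentiableOn_gaussQ differentiableOn_linForm margin_gaussQ_linForm)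
open Summit.QuantumFields.BalabanUV.T4Continuum.SubstrateGaussianLettersBall (detBudget differentiableOn_gaussN_linForm norm_gaussN_linForm_le)
open Summit.QuantumFields.BalabanUV.T4Continuum.B13AssemblyCoresEndSubstrateAmbient (ne5_substrate_cores_actNorm_ambient
  exists_ne5_substrate_cores_actNorm_ambient)

variable {G : Type} [GaugeGroup G] (D : DrivenRuns G)
variable {o : Type} [Fintype o] [DecidableEq o] (ι : G →* Matrix o o ℂ) (c : ℂ) (a : ℝ) (s : ℕ → ℂ)
variable {T ι' S Ω 𝒴 : Type} [MeasurableSpace Ω] (P : MeasPotFrame D.carriers) {IOp : Type*}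
  (𝒵 : D.carriers.Dom → InnerLabel D.carriers.Dom (Bnd D.toTwoRuns) → Type) [∀ Z j, Fintype (𝒵 Z j)] (dom : ∀ Z j, 𝒵 Z j → D.carriers.Dom)
  (Jc : D.carriers.Dom → InnerLabel D.carriers.Dom (Bnd D.toTwoRuns) → Type) [∀ Z j, Fintype (Jc Z j)]
  (V : D.carriers.Dom → InnerLabel D.carriers.Dom (Bnd D.toTwoRuns) → Type) [∀ Z j, NormedAddCommGroup (V Z j)]
  [∀ Z j, InnerProductSpace ℝ (V Z j)] [∀ Z j, MeasurableSpace (V Z j)] [∀ Z j, BorelSpace (V Z j)] [∀ Z j, FiniteDimensional ℝ (V Z j)]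
  (mI : D.carriers.Dom → InnerLabel D.carriers.Dom (Bnd D.toTwoRuns) → Type) [∀ Z j, Fintype (mI Z j)] [∀ Z j, DecidableEq (mI Z j)]
  (L : SlotLetters D (o := o) (T := T) (ι' := ι') (S := S) (Ω := Ω) (𝒴 := 𝒴) P (IOp := IOp) 𝒵 dom Jc V mI)

section Instance

variable
  -- p221190 §1's letter conditions (replace `hMA` ∕ `hMB` at `M := measOp`)
  (hbdA : ∀ (g : ℕ → ℝ) (U : D.carriers.BgA) (k : ℕ),
    FormatBounded (L.W k).format (rawAOfRecord ι D c a s L.ΓA L.dkA L.gcA L.pQA L.pRA g U k).kernel)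
  (hmQA : ∀ (r : ℝ) (U : GaugeField (D.F.P D.K) 0 G) (k : ℕ) (Y : 𝒴) (b b' : ((Tor (unitMod (D.F.P D.K)) × Fin (D.F.P D.K).d) × o)),
    Measurable fun x : Ω => L.pQA r U k x Y b b')
  (hmRA : ∀ (r : ℝ) (U : GaugeField (D.F.P D.K) 0 G) (k : ℕ) (Y : 𝒴), Measurable fun x : Ω => L.pRA r U k x Y)
  (hbdB : ∀ (g : ℕ → ℝ) (U : D.carriers.BgB) (k : ℕ),
    FormatBounded (L.W k).format (rawBOfRecord ι D c a s L.ΓB L.dkB L.gcB L.pQB L.pRB g U k).kernel)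
  (hmQB : ∀ (r : ℝ) (U : GaugeField (D.F.P (D.K + 1)) 0 G) (k : ℕ) (Y : 𝒴) (b b' : ((Tor (unitMod (D.F.P D.K)) × Fin (D.F.P D.K).d) × o)),
    Measurable fun x : Ω => L.pQB r U k x Y b b')
  (hmRB : ∀ (r : ℝ) (U : GaugeField (D.F.P (D.K + 1)) 0 G) (k : ℕ) (Y : 𝒴), Measurable fun x : Ω => L.pRB r U k x Y)
  -- p221190 §2's factorisation datum (replaces `hT`)
  (iopAt : ℝ → D.carriers.BgA → ℕ → IOp)
  (hiopA : ∀ (r : ℝ) (U : D.carriers.BgB) (k : ℕ), L.ins.iopA r U k = iopAt r (D.carriers.transport U) k)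
  (E₀ cB : ℝ)

/-! ## §1 The (2.14)-factor-core END of record at the substrate's slots of record on `measOp`, factor letters discharged into the substrate's letter conditions -/

include hbdA hmQA hmRA hbdB hmQB hmRB hiopA in
/-- [folklore] **THE (2.14)-FACTOR-CORE END OF RECORD AT THE SUBSTRATE's SLOTS OF RECORD ON `measOp`, FACTOR LETTERS DISCHARGED INTO THE
SUBSTRATE's LETTER CONDITIONS** — module 2's `ne5_substrate_cores_actNorm_ambient` with `hNf` produced by `measurable_gaussN ∘ measurable_linForm`,
`differentiableOn_gaussN_linForm`, `norm_gaussN_linForm_le` (p219426 ∕ p219975) and `hqf` by `aestronglyMeasurable_gaussQ`, `differentiableOn_gaussQ ∘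
differentiableOn_linForm`, `margin_gaussQ_linForm` (+ monotonicity of the margin in the radius `R′ k ≤ R̄`), the bound ∕ margin letters SPECIALISED to
`N₀f Z j := gaussC (mI Z j)·√(max 1 ((card mI)!·β₀^{card mI} + d₀))`, `mf Z j := (γ − card mI·ϑ·R̄)∕2`, `bf := 0` (so `hN₀` is proved).  DISPLAYED instead:
measurability of `base`, `rd` in the contour parameter; `0 ≤ β₀`, `0 ≤ ϑ`, `0 < d₀`, `R′ k ≤ R̄` (`0 ≤ R′ k` is derived from the rooms); the read-out bound `‖rd p ii jj‖ ≤ ϑ`; the CENTRE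
CONDITIONS at run B's datum of record (entries `≤ β₀`, real determinant with real part `≥ d₀`, `γ`-coercivity, `detBudget (card mI) β₀ ϑ (R′ k) < d₀`).
Every other binder of module 2 VERBATIM; conclusion LITERALLY `T4OutputRate.NE5 (B13StepOfRecord.outA (slotsOfRecord …) E₀ cB) (B13StepOfRecord.outB
(slotsOfRecord …) E₀ cB) W κ θ′ C₅`, the diamond's `C₅`.  «NE5 ⇐ the instance» — NOT NE5 proved; nothing of the substrate's instance asserted. -/
theorem ne5_substrate_cores_actNorm_letters {W : Set (ℕ → ℝ)} {ROp RHist R' H : ℕ → ℝ}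
    {β₀ ϑ d₀ γ : D.carriers.Dom → InnerLabel D.carriers.Dom (Bnd D.toTwoRuns) → ℝ} {Rbar : ℝ}
    {A' : ℕ → D.carriers.Dom → InnerLabel D.carriers.Dom (Bnd D.toTwoRuns) → ℝ}
    {mstar κ Φ' EA₀ E₁ cA c₁ r₀ δ' θ θ' ρ₀ B : ℝ} {k₀ : ℕ}
    (hbB : (assembly (slotsOfRecord D ι c a s P 𝒵 dom Jc V mI L)).SliceBudgetB W κ cB)
    (hbA : (slotsOfRecord D ι c a s P 𝒵 dom Jc V mI L).D.SliceBudget (step (slotsOfRecord D ι c a s P 𝒵 dom Jc V mI L) E₀ cB) W κ cA)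
    (hdA : DecayBound (B13StepOfRecord.outA (slotsOfRecord D ι c a s P 𝒵 dom Jc V mI L) E₀ cB) W EA₀ κ)
    (hdB : DecayBound (B13StepOfRecord.outB (slotsOfRecord D ι c a s P 𝒵 dom Jc V mI L) E₀ cB) W E₀ κ)
    (hRA : RawBounded (slotsOfRecord D ι c a s P 𝒵 dom Jc V mI L).F (assembly (slotsOfRecord D ι c a s P 𝒵 dom Jc V mI L)).rawAt W)
    (hRB : RawBounded (slotsOfRecord D ι c a s P 𝒵 dom Jc V mI L).F (slotsOfRecord D ι c a s P 𝒵 dom Jc V mI L).rawB W)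
    (hwer : WeightedEntrywiseRate (slotsOfRecord D ι c a s P 𝒵 dom Jc V mI L).F (assembly (slotsOfRecord D ι c a s P 𝒵 dom Jc V mI L)).rawAt
      (slotsOfRecord D ι c a s P 𝒵 dom Jc V mI L).rawB W c₁ fun k => θ ^ k)
    (hfl : ∀ k, r₀ ≤ L.rOp k)
    (hins : (step (slotsOfRecord D ι c a s P 𝒵 dom Jc V mI L) E₀ cB).InsertionRate W κ E₀ δ' θ)
    (hOp : ∀ k, L.rOp k ≤ ROp k) (hroom : ∀ k, ROp k < R' k)
    (hHist : ∀ k, (assembly (slotsOfRecord D ι c a s P 𝒵 dom Jc V mI L)).bHist E₀ cB k + L.rHist k ≤ RHist k)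
    -- the factor letters: the substrate's PRIMITIVE per-factor letter conditions (S-U3 currency) replacing `hNf` ∕ `hqf` ∕ `hN₀`
    (hm : 0 < mstar) (hmf : ∀ Z ℓ, mstar ≤ (γ Z ℓ - Fintype.card (mI Z ℓ) * ϑ Z ℓ * Rbar) / 2)
    (hbase : ∀ Z j ii jj, Measurable fun p => (L.A Z j).base p ii jj)
    (hrdm : ∀ Z j ii jj (o' : OpDatum (SpeciesRec D o T ι' Ω 𝒴)), Measurable fun p => (L.A Z j).rd p ii jj o')
    (hβ₀ : ∀ Z j, 0 ≤ β₀ Z j) (hϑ : ∀ Z j, 0 ≤ ϑ Z j) (hd₀ : ∀ Z j, 0 < d₀ Z j) (hRbar : ∀ k, R' k ≤ Rbar)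
    (hrd : ∀ Z j p ii jj, ‖(L.A Z j).rd p ii jj‖ ≤ ϑ Z j)
    -- the CENTRE CONDITIONS at run B's datum of record: entry bound, real determinant with real part `≥ d₀`, `γ`-coercivity
    (hctr : ∀ k, ∀ g ∈ W, ∀ (U : D.carriers.BgB) (X : D.carriers.Dom), D.carriers.scale X = k →
      ∀ i, (assembly (slotsOfRecord D ι c a s P 𝒵 dom Jc V mI L)).𝒯.Rel k i X →
      ∀ (m : Fin ((assembly (slotsOfRecord D ι c a s P 𝒵 dom Jc V mI L)).𝒯.len i + 1))
        (p : (Jc ((assembly (slotsOfRecord D ι c a s P 𝒵 dom Jc V mI L)).𝒯.poly i m) ((assembly (slotsOfRecord D ι c a s P 𝒵 dom Jc V mI L)).𝒯.lab i m) ⊕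
          𝒵 ((assembly (slotsOfRecord D ι c a s P 𝒵 dom Jc V mI L)).𝒯.poly i m) ((assembly (slotsOfRecord D ι c a s P 𝒵 dom Jc V mI L)).𝒯.lab i m)) → ℝ × ℝ),
      -- (i) centre entries bounded by `β₀`
      (∀ ii jj, ‖linForm
            (L.A ((assembly (slotsOfRecord D ι c a s P 𝒵 dom Jc V mI L)).𝒯.poly i m) ((assembly (slotsOfRecord D ι c a s P 𝒵 dom Jc V mI L)).𝒯.lab i m)).base
            (L.A ((assembly (slotsOfRecord D ι c a s P 𝒵 dom Jc V mI L)).𝒯.poly i m) ((assembly (slotsOfRecord D ι c a s P 𝒵 dom Jc V mI L)).𝒯.lab i m)).rd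
            (opOf (slotsOfRecord D ι c a s P 𝒵 dom Jc V mI L).F (slotsOfRecord D ι c a s P 𝒵 dom Jc V mI L).rawB g U k) p ii jj‖ ≤
          β₀ ((assembly (slotsOfRecord D ι c a s P 𝒵 dom Jc V mI L)).𝒯.poly i m) ((assembly (slotsOfRecord D ι c a s P 𝒵 dom Jc V mI L)).𝒯.lab i m)) ∧
      -- (ii) centre determinant real …
      ((linForm
            (L.A ((assembly (slotsOfRecord D ι c a s P 𝒵 dom Jc V mI L)).𝒯.poly i m) ((assembly (slotsOfRecord D ι c a s P 𝒵 dom Jc V mI L)).𝒯.lab i m)).base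
            (L.A ((assembly (slotsOfRecord D ι c a s P 𝒵 dom Jc V mI L)).𝒯.poly i m) ((assembly (slotsOfRecord D ι c a s P 𝒵 dom Jc V mI L)).𝒯.lab i m)).rd
            (opOf (slotsOfRecord D ι c a s P 𝒵 dom Jc V mI L).F (slotsOfRecord D ι c a s P 𝒵 dom Jc V mI L).rawB g U k) p).det).im = 0 ∧
      -- (iii) … with real part at least `d₀`
      d₀ ((assembly (slotsOfRecord D ι c a s P 𝒵 dom Jc V mI L)).𝒯.poly i m) ((assembly (slotsOfRecord D ι c a s P 𝒵 dom Jc V mI L)).𝒯.lab i m) ≤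
        ((linForm
            (L.A ((assembly (slotsOfRecord D ι c a s P 𝒵 dom Jc V mI L)).𝒯.poly i m) ((assembly (slotsOfRecord D ι c a s P 𝒵 dom Jc V mI L)).𝒯.lab i m)).base
            (L.A ((assembly (slotsOfRecord D ι c a s P 𝒵 dom Jc V mI L)).𝒯.poly i m) ((assembly (slotsOfRecord D ι c a s P 𝒵 dom Jc V mI L)).𝒯.lab i m)).rd
            (opOf (slotsOfRecord D ι c a s P 𝒵 dom Jc V mI L).F (slotsOfRecord D ι c a s P 𝒵 dom Jc V mI L).rawB g U k) p).det).re ∧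
      -- (iv) `γ`-coercivity of the centre form
      (∀ x : mI ((assembly (slotsOfRecord D ι c a s P 𝒵 dom Jc V mI L)).𝒯.poly i m) ((assembly (slotsOfRecord D ι c a s P 𝒵 dom Jc V mI L)).𝒯.lab i m) → ℂ,
        γ ((assembly (slotsOfRecord D ι c a s P 𝒵 dom Jc V mI L)).𝒯.poly i m) ((assembly (slotsOfRecord D ι c a s P 𝒵 dom Jc V mI L)).𝒯.lab i m) * nsq x ≤
          (star x ⬝ᵥ (linForm
            (L.A ((assembly (slotsOfRecord D ι c a s P 𝒵 dom Jc V mI L)).𝒯.poly i m) ((assembly (slotsOfRecord D ι c a s P 𝒵 dom Jc V mI L)).𝒯.lab i m)).base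
            (L.A ((assembly (slotsOfRecord D ι c a s P 𝒵 dom Jc V mI L)).𝒯.poly i m) ((assembly (slotsOfRecord D ι c a s P 𝒵 dom Jc V mI L)).𝒯.lab i m)).rd
            (opOf (slotsOfRecord D ι c a s P 𝒵 dom Jc V mI L).F (slotsOfRecord D ι c a s P 𝒵 dom Jc V mI L).rawB g U k) p *ᵥ x)).re) ∧
      -- (v) the determinant-budget smallness of the operator radius at this level for this factor
      detBudget (Fintype.card (mI ((assembly (slotsOfRecord D ι c a s P 𝒵 dom Jc V mI L)).𝒯.poly i m) ((assembly (slotsOfRecord D ι c a s P 𝒵 dom Jc V mI L)).𝒯.lab i m)))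
          (β₀ ((assembly (slotsOfRecord D ι c a s P 𝒵 dom Jc V mI L)).𝒯.poly i m) ((assembly (slotsOfRecord D ι c a s P 𝒵 dom Jc V mI L)).𝒯.lab i m))
          (ϑ ((assembly (slotsOfRecord D ι c a s P 𝒵 dom Jc V mI L)).𝒯.poly i m) ((assembly (slotsOfRecord D ι c a s P 𝒵 dom Jc V mI L)).𝒯.lab i m)) (R' k) <
        d₀ ((assembly (slotsOfRecord D ι c a s P 𝒵 dom Jc V mI L)).𝒯.poly i m) ((assembly (slotsOfRecord D ι c a s P 𝒵 dom Jc V mI L)).𝒯.lab i m))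
    (hH : ∀ k, ∀ g ∈ W, ∀ U : D.carriers.BgB, ‖(assembly (slotsOfRecord D ι c a s P 𝒵 dom Jc V mI L)).histRef g U k‖ + RHist k ≤ H k)
    -- the stripped majorant's decay split and anchored exponential norm
    (hκ : 0 ≤ κ) (hA0' : ∀ k Z ℓ, 0 ≤ A' k Z ℓ)
    (hdec : ∀ k Z ℓ, factorMass (coresRec D P 𝒵 dom Jc V mI L)
      (fun Z j => gaussC (mI Z j) * Real.sqrt (max 1 ((Fintype.card (mI Z j)).factorial * β₀ Z j ^ Fintype.card (mI Z j) + d₀ Z j)))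
      (fun _ _ => (0 : ℝ)) mstar (H k) Z ℓ ≤ A' k Z ℓ * Real.exp (-(κ * (D.carriers.d Z + 5))))
    (hΦ0 : 0 ≤ Φ') (hsmallΦ : 36 * Φ' < 1)
    (hΦ : ∀ (k : ℕ) (q : SCube D.toTwoRuns), ∑ Z ∈ D.toTwoRuns.domAt k,
      ind (q ∈ footprint Z) * actSum (b13InnerData D.toTwoRuns) (A' k) k Z * Real.exp ((footprint Z).card) ≤ Φ')
    (hE₀ : 0 ≤ E₀) (hE₁ : 0 < E₁) (hcA : 0 ≤ cA) (hcB : 0 ≤ cB) (hc₁ : 0 ≤ c₁) (hr₀ : 0 < r₀) (hδ' : 0 ≤ δ')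
    (hθ : 0 ≤ θ) (hθθ' : θ ≤ θ') (hθ'1 : θ' ≤ 1) (hω : 0 < L.ins.ω) (hω1 : L.ins.ω < 1) (hρ₀ : ρ₀ < 1)
    (hnear : (c₁ / r₀ + δ') * θ ^ k₀ + cA * (EA₀ + E₀) / (1 - L.ins.ω) ≤ ρ₀) (hB : 0 ≤ B)
    (hfirst : ∀ k < k₀, EA₀ + E₀ ≤ B * θ ^ k)
    (hsmall : L.ins.ω + Φ' / (1 - 36 * Φ') / (1 - ρ₀) * cA < θ') :
    NE5 (B13StepOfRecord.outA (slotsOfRecord D ι c a s P 𝒵 dom Jc V mI L) E₀ cB)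
      (B13StepOfRecord.outB (slotsOfRecord D ι c a s P 𝒵 dom Jc V mI L) E₀ cB) W κ θ'
      ((Φ' / (1 - 36 * Φ') / (1 - ρ₀) * (c₁ / r₀) + Φ' / (1 - 36 * Φ') / (1 - ρ₀) * δ' + B) * (θ' - L.ins.ω) /
        (θ' - (L.ins.ω + Φ' / (1 - 36 * Φ') / (1 - ρ₀) * cA))) :=
  ne5_substrate_cores_actNorm_ambient D ι c a s P 𝒵 dom Jc V mI L hbdA hmQA hmRA hbdB hmQB hmRB iopAt hiopA E₀ cB
    (N₀f := fun Z j => gaussC (mI Z j) * Real.sqrt (max 1 ((Fintype.card (mI Z j)).factorial * β₀ Z j ^ Fintype.card (mI Z j) + d₀ Z j)))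
    (mf := fun Z j => (γ Z j - Fintype.card (mI Z j) * ϑ Z j * Rbar) / 2) (bf := fun _ _ => (0 : ℝ))
    hbB hbA hdA hdB hRA hRB hwer hfl hins hOp hroom hHist hm hmf (fun Z ℓ => mul_nonneg gaussC_pos.le (Real.sqrt_nonneg _))
    (fun k g hg U X hX i hi m => by
      refine ⟨fun op _ => (measurable_gaussN _ (measurable_linForm
          (L.A ((assembly (slotsOfRecord D ι c a s P 𝒵 dom Jc V mI L)).𝒯.poly i m) ((assembly (slotsOfRecord D ι c a s P 𝒵 dom Jc V mI L)).𝒯.lab i m)).base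
          (L.A ((assembly (slotsOfRecord D ι c a s P 𝒵 dom Jc V mI L)).𝒯.poly i m) ((assembly (slotsOfRecord D ι c a s P 𝒵 dom Jc V mI L)).𝒯.lab i m)).rd
          (hbase _ _) (hrdm _ _) op)).aestronglyMeasurable, fun p => ?_, fun op hop p => ?_⟩
      · obtain ⟨hc, hreal, hpos, -, hdet⟩ := hctr k g hg U X hX i hi m p
        exact differentiableOn_gaussN_linForm _ _ (hβ₀ _ _) (((L.rOp_pos k).le.trans (hOp k)).trans (hroom k).le) hc (hrd _ _ p) hreal (hd₀ _ _) hpos hdet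
      · obtain ⟨hc, -, -, -, hdet⟩ := hctr k g hg U X hX i hi m p
        exact norm_gaussN_linForm_le _ _ (hβ₀ _ _) (((L.rOp_pos k).le.trans (hOp k)).trans (hroom k).le) hc (hrd _ _ p) hdet hop)
    (fun k g hg U X hX i hi m => by
      refine ⟨fun op _ => aestronglyMeasurable_gaussQ _
          (L.A ((assembly (slotsOfRecord D ι c a s P 𝒵 dom Jc V mI L)).𝒯.poly i m) ((assembly (slotsOfRecord D ι c a s P 𝒵 dom Jc V mI L)).𝒯.lab i m)).coords
          (measurable_linForm
            (L.A ((assembly (slotsOfRecord D ι c a s P 𝒵 dom Jc V mI L)).𝒯.poly i m) ((assembly (slotsOfRecord D ι c a s P 𝒵 dom Jc V mI L)).𝒯.lab i m)).base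
            (L.A ((assembly (slotsOfRecord D ι c a s P 𝒵 dom Jc V mI L)).𝒯.poly i m) ((assembly (slotsOfRecord D ι c a s P 𝒵 dom Jc V mI L)).𝒯.lab i m)).rd
            (hbase _ _) (hrdm _ _) op) _ _,
        fun p v => differentiableOn_gaussQ _
          (L.A ((assembly (slotsOfRecord D ι c a s P 𝒵 dom Jc V mI L)).𝒯.poly i m) ((assembly (slotsOfRecord D ι c a s P 𝒵 dom Jc V mI L)).𝒯.lab i m)).coords
          (fun ii jj => differentiableOn_linForm
            (L.A ((assembly (slotsOfRecord D ι c a s P 𝒵 dom Jc V mI L)).𝒯.poly i m) ((assembly (slotsOfRecord D ι c a s P 𝒵 dom Jc V mI L)).𝒯.lab i m)).base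
            (L.A ((assembly (slotsOfRecord D ι c a s P 𝒵 dom Jc V mI L)).𝒯.poly i m) ((assembly (slotsOfRecord D ι c a s P 𝒵 dom Jc V mI L)).𝒯.lab i m)).rd _ p ii jj) v,
        fun op hop p v => ?_⟩
      obtain ⟨-, -, -, hco, -⟩ := hctr k g hg U X hX i hi m p
      refine le_trans ?_ (margin_gaussQ_linForm _ _ _ hco (hrd _ _ p) hop v)
      have hmono : (Fintype.card (mI ((assembly (slotsOfRecord D ι c a s P 𝒵 dom Jc V mI L)).𝒯.poly i m)
            ((assembly (slotsOfRecord D ι c a s P 𝒵 dom Jc V mI L)).𝒯.lab i m)) : ℝ) *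
          ϑ ((assembly (slotsOfRecord D ι c a s P 𝒵 dom Jc V mI L)).𝒯.poly i m) ((assembly (slotsOfRecord D ι c a s P 𝒵 dom Jc V mI L)).𝒯.lab i m) * R' k ≤
          (Fintype.card (mI ((assembly (slotsOfRecord D ι c a s P 𝒵 dom Jc V mI L)).𝒯.poly i m)
            ((assembly (slotsOfRecord D ι c a s P 𝒵 dom Jc V mI L)).𝒯.lab i m)) : ℝ) *
          ϑ ((assembly (slotsOfRecord D ι c a s P 𝒵 dom Jc V mI L)).𝒯.poly i m) ((assembly (slotsOfRecord D ι c a s P 𝒵 dom Jc V mI L)).𝒯.lab i m) * Rbar :=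
        mul_le_mul_of_nonneg_left (hRbar k) (mul_nonneg (Nat.cast_nonneg _) (hϑ _ _))
      nlinarith [mul_nonneg (sub_nonneg.mpr hmono) (sq_nonneg ‖v‖)])
    hH hκ hA0' hdec hΦ0 hsmallΦ hΦ hE₀ hE₁ hcA hcB hc₁ hr₀ hδ' hθ hθθ' hθ'1 hω hω1 hρ₀ hnear hB hfirst hsmall

/-! ## §2 The chained face, factor letters discharged -/

include hbdA hmQA hmRA hbdB hmQB hmRB hiopA in
/-- [folklore] **THE CHAINED (2.14)-FACTOR-CORE END OF RECORD AT THE SUBSTRATE's SLOTS OF RECORD ON `measOp`, FACTOR LETTERS DISCHARGED** —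
module 2's `exists_ne5_substrate_cores_actNorm_ambient` (arithmetic letters eliminated) with `hNf` ∕ `hqf` ∕ `hN₀` produced from the substrate's letter
conditions the same way ⟹ `∃ C₅, NE5 (B13StepOfRecord.outA (slotsOfRecord …) E₀ cB) (B13StepOfRecord.outB (slotsOfRecord …) E₀ cB) W κ θ′ C₅`.
«NE5 ⇐ the instance». -/
theorem exists_ne5_substrate_cores_actNorm_letters {W : Set (ℕ → ℝ)} {ROp RHist R' H : ℕ → ℝ}
    {β₀ ϑ d₀ γ : D.carriers.Dom → InnerLabel D.carriers.Dom (Bnd D.toTwoRuns) → ℝ} {Rbar : ℝ}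
    {A' : ℕ → D.carriers.Dom → InnerLabel D.carriers.Dom (Bnd D.toTwoRuns) → ℝ}
    {mstar κ Φ' EA₀ cA c₁ r₀ δ' θ θ' : ℝ}
    (hbB : (assembly (slotsOfRecord D ι c a s P 𝒵 dom Jc V mI L)).SliceBudgetB W κ cB)
    (hbA : (slotsOfRecord D ι c a s P 𝒵 dom Jc V mI L).D.SliceBudget (step (slotsOfRecord D ι c a s P 𝒵 dom Jc V mI L) E₀ cB) W κ cA)
    (hdA : DecayBound (B13StepOfRecord.outA (slotsOfRecord D ι c a s P 𝒵 dom Jc V mI L) E₀ cB) W EA₀ κ)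
    (hdB : DecayBound (B13StepOfRecord.outB (slotsOfRecord D ι c a s P 𝒵 dom Jc V mI L) E₀ cB) W E₀ κ)
    (hRA : RawBounded (slotsOfRecord D ι c a s P 𝒵 dom Jc V mI L).F (assembly (slotsOfRecord D ι c a s P 𝒵 dom Jc V mI L)).rawAt W)
    (hRB : RawBounded (slotsOfRecord D ι c a s P 𝒵 dom Jc V mI L).F (slotsOfRecord D ι c a s P 𝒵 dom Jc V mI L).rawB W)
    (hwer : WeightedEntrywiseRate (slotsOfRecord D ι c a s P 𝒵 dom Jc V mI L).F (assembly (slotsOfRecord D ι c a s P 𝒵 dom Jc V mI L)).rawAt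
      (slotsOfRecord D ι c a s P 𝒵 dom Jc V mI L).rawB W c₁ fun k => θ ^ k)
    (hfl : ∀ k, r₀ ≤ L.rOp k)
    (hins : (step (slotsOfRecord D ι c a s P 𝒵 dom Jc V mI L) E₀ cB).InsertionRate W κ E₀ δ' θ)
    (hOp : ∀ k, L.rOp k ≤ ROp k) (hroom : ∀ k, ROp k < R' k)
    (hHist : ∀ k, (assembly (slotsOfRecord D ι c a s P 𝒵 dom Jc V mI L)).bHist E₀ cB k + L.rHist k ≤ RHist k)
    -- the factor letters: the substrate's PRIMITIVE per-factor letter conditions (S-U3 currency) replacing `hNf` ∕ `hqf` ∕ `hN₀`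
    (hm : 0 < mstar) (hmf : ∀ Z ℓ, mstar ≤ (γ Z ℓ - Fintype.card (mI Z ℓ) * ϑ Z ℓ * Rbar) / 2)
    (hbase : ∀ Z j ii jj, Measurable fun p => (L.A Z j).base p ii jj)
    (hrdm : ∀ Z j ii jj (o' : OpDatum (SpeciesRec D o T ι' Ω 𝒴)), Measurable fun p => (L.A Z j).rd p ii jj o')
    (hβ₀ : ∀ Z j, 0 ≤ β₀ Z j) (hϑ : ∀ Z j, 0 ≤ ϑ Z j) (hd₀ : ∀ Z j, 0 < d₀ Z j) (hRbar : ∀ k, R' k ≤ Rbar)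
    (hrd : ∀ Z j p ii jj, ‖(L.A Z j).rd p ii jj‖ ≤ ϑ Z j)
    -- the CENTRE CONDITIONS at run B's datum of record: entry bound, real determinant with real part `≥ d₀`, `γ`-coercivity
    (hctr : ∀ k, ∀ g ∈ W, ∀ (U : D.carriers.BgB) (X : D.carriers.Dom), D.carriers.scale X = k →
      ∀ i, (assembly (slotsOfRecord D ι c a s P 𝒵 dom Jc V mI L)).𝒯.Rel k i X →
      ∀ (m : Fin ((assembly (slotsOfRecord D ι c a s P 𝒵 dom Jc V mI L)).𝒯.len i + 1))
        (p : (Jc ((assembly (slotsOfRecord D ι c a s P 𝒵 dom Jc V mI L)).𝒯.poly i m) ((assembly (slotsOfRecord D ι c a s P 𝒵 dom Jc V mI L)).𝒯.lab i m) ⊕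
          𝒵 ((assembly (slotsOfRecord D ι c a s P 𝒵 dom Jc V mI L)).𝒯.poly i m) ((assembly (slotsOfRecord D ι c a s P 𝒵 dom Jc V mI L)).𝒯.lab i m)) → ℝ × ℝ),
      -- (i) centre entries bounded by `β₀`
      (∀ ii jj, ‖linForm
            (L.A ((assembly (slotsOfRecord D ι c a s P 𝒵 dom Jc V mI L)).𝒯.poly i m) ((assembly (slotsOfRecord D ι c a s P 𝒵 dom Jc V mI L)).𝒯.lab i m)).base
            (L.A ((assembly (slotsOfRecord D ι c a s P 𝒵 dom Jc V mI L)).𝒯.poly i m) ((assembly (slotsOfRecord D ι c a s P 𝒵 dom Jc V mI L)).𝒯.lab i m)).rd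
            (opOf (slotsOfRecord D ι c a s P 𝒵 dom Jc V mI L).F (slotsOfRecord D ι c a s P 𝒵 dom Jc V mI L).rawB g U k) p ii jj‖ ≤
          β₀ ((assembly (slotsOfRecord D ι c a s P 𝒵 dom Jc V mI L)).𝒯.poly i m) ((assembly (slotsOfRecord D ι c a s P 𝒵 dom Jc V mI L)).𝒯.lab i m)) ∧
      -- (ii) centre determinant real …
      ((linForm
            (L.A ((assembly (slotsOfRecord D ι c a s P 𝒵 dom Jc V mI L)).𝒯.poly i m) ((assembly (slotsOfRecord D ι c a s P 𝒵 dom Jc V mI L)).𝒯.lab i m)).base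
            (L.A ((assembly (slotsOfRecord D ι c a s P 𝒵 dom Jc V mI L)).𝒯.poly i m) ((assembly (slotsOfRecord D ι c a s P 𝒵 dom Jc V mI L)).𝒯.lab i m)).rd
            (opOf (slotsOfRecord D ι c a s P 𝒵 dom Jc V mI L).F (slotsOfRecord D ι c a s P 𝒵 dom Jc V mI L).rawB g U k) p).det).im = 0 ∧
      -- (iii) … with real part at least `d₀`
      d₀ ((assembly (slotsOfRecord D ι c a s P 𝒵 dom Jc V mI L)).𝒯.poly i m) ((assembly (slotsOfRecord D ι c a s P 𝒵 dom Jc V mI L)).𝒯.lab i m) ≤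
        ((linForm
            (L.A ((assembly (slotsOfRecord D ι c a s P 𝒵 dom Jc V mI L)).𝒯.poly i m) ((assembly (slotsOfRecord D ι c a s P 𝒵 dom Jc V mI L)).𝒯.lab i m)).base
            (L.A ((assembly (slotsOfRecord D ι c a s P 𝒵 dom Jc V mI L)).𝒯.poly i m) ((assembly (slotsOfRecord D ι c a s P 𝒵 dom Jc V mI L)).𝒯.lab i m)).rd
            (opOf (slotsOfRecord D ι c a s P 𝒵 dom Jc V mI L).F (slotsOfRecord D ι c a s P 𝒵 dom Jc V mI L).rawB g U k) p).det).re ∧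
      -- (iv) `γ`-coercivity of the centre form
      (∀ x : mI ((assembly (slotsOfRecord D ι c a s P 𝒵 dom Jc V mI L)).𝒯.poly i m) ((assembly (slotsOfRecord D ι c a s P 𝒵 dom Jc V mI L)).𝒯.lab i m) → ℂ,
        γ ((assembly (slotsOfRecord D ι c a s P 𝒵 dom Jc V mI L)).𝒯.poly i m) ((assembly (slotsOfRecord D ι c a s P 𝒵 dom Jc V mI L)).𝒯.lab i m) * nsq x ≤
          (star x ⬝ᵥ (linForm
            (L.A ((assembly (slotsOfRecord D ι c a s P 𝒵 dom Jc V mI L)).𝒯.poly i m) ((assembly (slotsOfRecord D ι c a s P 𝒵 dom Jc V mI L)).𝒯.lab i m)).base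
            (L.A ((assembly (slotsOfRecord D ι c a s P 𝒵 dom Jc V mI L)).𝒯.poly i m) ((assembly (slotsOfRecord D ι c a s P 𝒵 dom Jc V mI L)).𝒯.lab i m)).rd
            (opOf (slotsOfRecord D ι c a s P 𝒵 dom Jc V mI L).F (slotsOfRecord D ι c a s P 𝒵 dom Jc V mI L).rawB g U k) p *ᵥ x)).re) ∧
      -- (v) the determinant-budget smallness of the operator radius at this level for this factor
      detBudget (Fintype.card (mI ((assembly (slotsOfRecord D ι c a s P 𝒵 dom Jc V mI L)).𝒯.poly i m) ((assembly (slotsOfRecord D ι c a s P 𝒵 dom Jc V mI L)).𝒯.lab i m)))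
          (β₀ ((assembly (slotsOfRecord D ι c a s P 𝒵 dom Jc V mI L)).𝒯.poly i m) ((assembly (slotsOfRecord D ι c a s P 𝒵 dom Jc V mI L)).𝒯.lab i m))
          (ϑ ((assembly (slotsOfRecord D ι c a s P 𝒵 dom Jc V mI L)).𝒯.poly i m) ((assembly (slotsOfRecord D ι c a s P 𝒵 dom Jc V mI L)).𝒯.lab i m)) (R' k) <
        d₀ ((assembly (slotsOfRecord D ι c a s P 𝒵 dom Jc V mI L)).𝒯.poly i m) ((assembly (slotsOfRecord D ι c a s P 𝒵 dom Jc V mI L)).𝒯.lab i m))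
    (hH : ∀ k, ∀ g ∈ W, ∀ U : D.carriers.BgB, ‖(assembly (slotsOfRecord D ι c a s P 𝒵 dom Jc V mI L)).histRef g U k‖ + RHist k ≤ H k)
    (hκ : 0 ≤ κ) (hA0' : ∀ k Z ℓ, 0 ≤ A' k Z ℓ)
    (hdec : ∀ k Z ℓ, factorMass (coresRec D P 𝒵 dom Jc V mI L)
      (fun Z j => gaussC (mI Z j) * Real.sqrt (max 1 ((Fintype.card (mI Z j)).factorial * β₀ Z j ^ Fintype.card (mI Z j) + d₀ Z j)))
      (fun _ _ => (0 : ℝ)) mstar (H k) Z ℓ ≤ A' k Z ℓ * Real.exp (-(κ * (D.carriers.d Z + 5))))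
    (hΦ0 : 0 ≤ Φ') (hsmallΦ : 36 * Φ' < 1)
    (hΦ : ∀ (k : ℕ) (q : SCube D.toTwoRuns), ∑ Z ∈ D.toTwoRuns.domAt k,
      ind (q ∈ footprint Z) * actSum (b13InnerData D.toTwoRuns) (A' k) k Z * Real.exp ((footprint Z).card) ≤ Φ')
    (hE₀ : 0 ≤ E₀) (hcA : 0 ≤ cA) (hcB : 0 ≤ cB) (hc₁ : 0 ≤ c₁) (hr₀ : 0 < r₀) (hδ' : 0 ≤ δ')
    (hθ0 : 0 < θ) (hθ1 : θ < 1) (hθθ' : θ ≤ θ') (hθ'1 : θ' ≤ 1) (hω : 0 < L.ins.ω) (hω1 : L.ins.ω < 1)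
    (hh : cA * (EA₀ + E₀) < 1 - L.ins.ω)
    (hsmall : L.ins.ω + Φ' / (1 - 36 * Φ') * cA * (1 - L.ins.ω) / (1 - L.ins.ω - cA * (EA₀ + E₀)) < θ') :
    ∃ C₅, NE5 (B13StepOfRecord.outA (slotsOfRecord D ι c a s P 𝒵 dom Jc V mI L) E₀ cB)
      (B13StepOfRecord.outB (slotsOfRecord D ι c a s P 𝒵 dom Jc V mI L) E₀ cB) W κ θ' C₅ :=
  exists_ne5_substrate_cores_actNorm_ambient D ι c a s P 𝒵 dom Jc V mI L hbdA hmQA hmRA hbdB hmQB hmRB iopAt hiopA E₀ cB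
    (N₀f := fun Z j => gaussC (mI Z j) * Real.sqrt (max 1 ((Fintype.card (mI Z j)).factorial * β₀ Z j ^ Fintype.card (mI Z j) + d₀ Z j)))
    (mf := fun Z j => (γ Z j - Fintype.card (mI Z j) * ϑ Z j * Rbar) / 2) (bf := fun _ _ => (0 : ℝ))
    hbB hbA hdA hdB hRA hRB hwer hfl hins hOp hroom hHist hm hmf (fun Z ℓ => mul_nonneg gaussC_pos.le (Real.sqrt_nonneg _))
    (fun k g hg U X hX i hi m => by
      refine ⟨fun op _ => (measurable_gaussN _ (measurable_linForm
          (L.A ((assembly (slotsOfRecord D ι c a s P 𝒵 dom Jc V mI L)).𝒯.poly i m) ((assembly (slotsOfRecord D ι c a s P 𝒵 dom Jc V mI L)).𝒯.lab i m)).base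
          (L.A ((assembly (slotsOfRecord D ι c a s P 𝒵 dom Jc V mI L)).𝒯.poly i m) ((assembly (slotsOfRecord D ι c a s P 𝒵 dom Jc V mI L)).𝒯.lab i m)).rd
          (hbase _ _) (hrdm _ _) op)).aestronglyMeasurable, fun p => ?_, fun op hop p => ?_⟩
      · obtain ⟨hc, hreal, hpos, -, hdet⟩ := hctr k g hg U X hX i hi m p
        exact differentiableOn_gaussN_linForm _ _ (hβ₀ _ _) (((L.rOp_pos k).le.trans (hOp k)).trans (hroom k).le) hc (hrd _ _ p) hreal (hd₀ _ _) hpos hdet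
      · obtain ⟨hc, -, -, -, hdet⟩ := hctr k g hg U X hX i hi m p
        exact norm_gaussN_linForm_le _ _ (hβ₀ _ _) (((L.rOp_pos k).le.trans (hOp k)).trans (hroom k).le) hc (hrd _ _ p) hdet hop)
    (fun k g hg U X hX i hi m => by
      refine ⟨fun op _ => aestronglyMeasurable_gaussQ _
          (L.A ((assembly (slotsOfRecord D ι c a s P 𝒵 dom Jc V mI L)).𝒯.poly i m) ((assembly (slotsOfRecord D ι c a s P 𝒵 dom Jc V mI L)).𝒯.lab i m)).coords
          (measurable_linForm
            (L.A ((assembly (slotsOfRecord D ι c a s P 𝒵 dom Jc V mI L)).𝒯.poly i m) ((assembly (slotsOfRecord D ι c a s P 𝒵 dom Jc V mI L)).𝒯.lab i m)).base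
            (L.A ((assembly (slotsOfRecord D ι c a s P 𝒵 dom Jc V mI L)).𝒯.poly i m) ((assembly (slotsOfRecord D ι c a s P 𝒵 dom Jc V mI L)).𝒯.lab i m)).rd
            (hbase _ _) (hrdm _ _) op) _ _,
        fun p v => differentiableOn_gaussQ _
          (L.A ((assembly (slotsOfRecord D ι c a s P 𝒵 dom Jc V mI L)).𝒯.poly i m) ((assembly (slotsOfRecord D ι c a s P 𝒵 dom Jc V mI L)).𝒯.lab i m)).coords
          (fun ii jj => differentiableOn_linForm
            (L.A ((assembly (slotsOfRecord D ι c a s P 𝒵 dom Jc V mI L)).𝒯.poly i m) ((assembly (slotsOfRecord D ι c a s P 𝒵 dom Jc V mI L)).𝒯.lab i m)).base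
            (L.A ((assembly (slotsOfRecord D ι c a s P 𝒵 dom Jc V mI L)).𝒯.poly i m) ((assembly (slotsOfRecord D ι c a s P 𝒵 dom Jc V mI L)).𝒯.lab i m)).rd _ p ii jj) v,
        fun op hop p v => ?_⟩
      obtain ⟨-, -, -, hco, -⟩ := hctr k g hg U X hX i hi m p
      refine le_trans ?_ (margin_gaussQ_linForm _ _ _ hco (hrd _ _ p) hop v)
      have hmono : (Fintype.card (mI ((assembly (slotsOfRecord D ι c a s P 𝒵 dom Jc V mI L)).𝒯.poly i m)
            ((assembly (slotsOfRecord D ι c a s P 𝒵 dom Jc V mI L)).𝒯.lab i m)) : ℝ) *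
          ϑ ((assembly (slotsOfRecord D ι c a s P 𝒵 dom Jc V mI L)).𝒯.poly i m) ((assembly (slotsOfRecord D ι c a s P 𝒵 dom Jc V mI L)).𝒯.lab i m) * R' k ≤
          (Fintype.card (mI ((assembly (slotsOfRecord D ι c a s P 𝒵 dom Jc V mI L)).𝒯.poly i m)
            ((assembly (slotsOfRecord D ι c a s P 𝒵 dom Jc V mI L)).𝒯.lab i m)) : ℝ) *
          ϑ ((assembly (slotsOfRecord D ι c a s P 𝒵 dom Jc V mI L)).𝒯.poly i m) ((assembly (slotsOfRecord D ι c a s P 𝒵 dom Jc V mI L)).𝒯.lab i m) * Rbar :=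
        mul_le_mul_of_nonneg_left (hRbar k) (mul_nonneg (Nat.cast_nonneg _) (hϑ _ _))
      nlinarith [mul_nonneg (sub_nonneg.mpr hmono) (sq_nonneg ‖v‖)])
    hH hκ hA0' hdec hΦ0 hsmallΦ hΦ hE₀ hcA hcB hc₁ hr₀ hδ' hθ0 hθ1 hθθ' hθ'1 hω hω1 hh hsmall

end Instance

end Summit.QuantumFields.BalabanUV.T4Continuum.B13AssemblyCoresEndSubstrateLetters

end
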